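import Summits.AtomisticToContinuum.FouriersLaw.Theorems.EmbeddedDrudeMourreAbelThermodynamicLimitKaramataRieszTwo
import Summits.AtomisticToContinuum.FouriersLaw.Theorems.EmbeddedDrudeMourreAbelThermodynamicLimitWitnessPositiveType
import Summits.AtomisticToContinuum.FouriersLaw.Theorems.EmbeddedDrudeMourreAbelThermodynamicLimitRegularDLRUnique
import Summits.AtomisticToContinuum.FouriersLaw.Theorems.EmbeddedDrudeMourreAbelThermodynamicLimitFixedHorizonMatchingWindowLeaves
import Summits.AtomisticToContinuum.FouriersLaw.Theorems.EmbeddedDrudeMourreAbelThermodynamicLimitAnchoredCorrelationTails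
import Summits.AtomisticToContinuum.FouriersLaw.Theorems.EmbeddedDrudeMourreAbelThermodynamicLimitFixedTimeOffsetMatching
import HarnessLib

/-!
# `stub_anchoredPostDarkOfDcLimit` (stub B) of line `loomis-compact-horizon-witness`, skeleton rev 4
(crux `EmbeddedDrudeMourre.AbelThermodynamicLimit`, item stmt-AtomisticToContinuum-12596;
`--supports` file proving the registered stub B verbatim, closes nothing)

**Anchored post-dark stability from the two limits (the window scheme read backwards).**
For `P = pinnedChain ω₂ lam β γ` (all `> 0`), `T > 0`, a REGULAR pair `(μT, D)` — `μT` DLR at `T`,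
shift-invariant, Buttà–Marchioro superstable; `D.carrier ⊆ bmGood`, `D` preserves `μT`, absolutely
convergent summed current correlations — and `L : ℝ`: if the anchored DC value of the open chain
converges, `A_N(0) = Σ_k ∫₀^∞ ⟨j_{c_N}(0) j_k(t)⟩_{N,T} dt → L` (`N → ∞`), and the Abel means of the
witness's current autocorrelation converge to the same limit, `∫₀^∞ e^{-νt} C_T(t) dt → L` (`ν ↓ 0`,
`C_T = D.currentCorrelation μT`), then for every `ε > 0` there is a compact horizon `τ₀ > 0` such that
for every `τ ≥ τ₀`, eventually in `N`,

  `|A_N(0) - W_N(τ)| ≤ ε`,  `W_N(τ) = Σ_k ∫₀^τ (1 - t/τ)² ⟨j_{c_N}(0) j_k(t)⟩_{N,T} dt`.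

Proof (`ε/3`). Three landed theorems of the line:
* S2 `stub_witnessPositiveType`: `C_T` is measurable, bounded by some `M`, and
  `∫₀ᵗ (t-u) C_T(u) du ≥ 0` for `t ≥ 0`;
* S1 `stub_karamataRieszTwo` (Hardy–Littlewood–Karamata, index 2): with the Abel hypothesis this gives
  the order-2 Riesz means `g(τ) = ∫₀^τ (1 - t/τ)² C_T(t) dt → L` (`τ → ∞`);
* S4 `stub_fixedHorizonMatchingOfDynamicalLeaves` fed the landed leaves `stub_anchoredCorrelationTails`
  (light cone of the open chain at fixed time), `stub_regularDLRUnique` (S7) and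
  `stub_fixedTimeOffsetMatching` (two-dynamics matching): `W_N(τ) → g(τ)` for each fixed `τ > 0`.
Then `|A_N(0) - W_N(τ)| ≤ |A_N(0) - L| + |L - g(τ)| + |g(τ) - W_N(τ)| ≤ ε` for `τ ≥ τ₀(ε)` and
`N ≥ N₀(ε, τ)` (`window_stability_of_tendsto`, pure real variables). No definitions.
-/

noncomputable section

open MeasureTheory Filter Set
open scoped Topology NNReal BigOperators

namespace Summit.AtomisticToContinuum.FouriersLaw.Theorems.AbelThermodynamicLimit.LoomisCompactHorizonWitness

open Literature.MathematicalPhysics.KineticTheory.HeatConduction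

/-- Real-variable scheme behind stub B (the window scheme of `tendsto_of_window_scheme` read backwards):
if `d N → L` (`N → ∞`), `g τ → L` (`τ → ∞`) and `W N τ → g τ` for each fixed `τ > 0` (`N → ∞`), then for
every `ε > 0` there is `τ₀ > 0` such that for all `τ ≥ τ₀` eventually `|d N - W N τ| ≤ ε`
(`ε/3` bookkeeping through `L` and `g τ`). [folklore] -/
theorem window_stability_of_tendsto {d : ℕ → ℝ} {W : ℕ → ℝ → ℝ} {g : ℝ → ℝ} {L : ℝ}
    (hd : Tendsto d atTop (𝓝 L)) (hg : Tendsto g atTop (𝓝 L))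
    (hW : ∀ τ : ℝ, 0 < τ → Tendsto (fun N => W N τ) atTop (𝓝 (g τ))) :
    ∀ ε : ℝ, 0 < ε → ∃ τ₀ : ℝ, 0 < τ₀ ∧ ∀ τ : ℝ, τ₀ ≤ τ → ∃ N₀ : ℕ, ∀ N : ℕ, N₀ ≤ N →
      |d N - W N τ| ≤ ε := by
  intro ε hε
  have hε3 : 0 < ε / 3 := by positivity
  obtain ⟨τ₁, hτ₁⟩ := (Metric.tendsto_atTop.mp hg) (ε / 3) hε3
  refine ⟨max τ₁ 1, lt_of_lt_of_le one_pos (le_max_right _ _), fun τ hτ => ?_⟩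
  have hτpos : 0 < τ := lt_of_lt_of_le (lt_of_lt_of_le one_pos (le_max_right _ _)) hτ
  obtain ⟨N₁, hN₁⟩ := (Metric.tendsto_atTop.mp hd) (ε / 3) hε3
  obtain ⟨N₂, hN₂⟩ := (Metric.tendsto_atTop.mp (hW τ hτpos)) (ε / 3) hε3
  refine ⟨max N₁ N₂, fun N hN => ?_⟩
  have h1 : |d N - L| < ε / 3 := by
    have := hN₁ N (le_trans (le_max_left _ _) hN)
    rwa [Real.dist_eq] at this
  have h2 : |g τ - W N τ| < ε / 3 := by
    have := hN₂ N (le_trans (le_max_right _ _) hN)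
    rwa [Real.dist_eq, abs_sub_comm] at this
  have h3 : |L - g τ| < ε / 3 := by
    have := hτ₁ τ (le_trans (le_max_left _ _) hτ)
    rwa [Real.dist_eq, abs_sub_comm] at this
  have h4 := abs_sub_le (d N) L (W N τ)
  have h5 := abs_sub_le L (g τ) (W N τ)
  linarith

/-- **Registered stub B `stub_anchoredPostDarkOfDcLimit` of line `loomis-compact-horizon-witness` (rev 4) —
ANCHORED POST-DARK STABILITY FROM THE TWO LIMITS (the window scheme read backwards).**
For `P = pinnedChain ω₂ lam β γ` (all `> 0`), `T > 0`, a regular pair `(μT, D)` (DLR + shift-invariant +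
BM-superstable state, `D.carrier ⊆ bmGood`, `μT`-preserving, absolutely convergent correlations) and `L : ℝ`:
IF `A_N(0) → L` and `∫₀^∞ e^{-νt} C_T(t) dt → L` (`ν ↓ 0`), THEN
`∀ ε > 0 ∃ τ₀ > 0 ∀ τ ≥ τ₀ ∃ N₀ ∀ N ≥ N₀ (N ≥ 2), |A_N(0) - W_N(τ)| ≤ ε`,
`W_N(τ) = Σ_k ∫₀^τ (1-t/τ)² ⟨j_{c_N}(0) j_k(t)⟩_{N,T} dt`.
Proof: S2 `stub_witnessPositiveType` + S1 `stub_karamataRieszTwo` give `∫₀^τ (1-t/τ)² C_T → L`;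
S4 `stub_fixedHorizonMatchingOfDynamicalLeaves` (fed `stub_anchoredCorrelationTails`, S7 `stub_regularDLRUnique`,
`stub_fixedTimeOffsetMatching`) gives `W_N(τ) → ∫₀^τ (1-t/τ)² C_T` for each `τ > 0`; then `ε/3`
(`window_stability_of_tendsto`) and `dif_pos`. [folklore] -/
theorem stub_anchoredPostDarkOfDcLimit :
    ∀ ω₂ lam β γ : ℝ, 0 < ω₂ → 0 < lam → 0 < β → 0 < γ → ∀ T : ℝ, 0 < T →
      ∀ (μT : MeasureTheory.Measure
            Literature.MathematicalPhysics.KineticTheory.HeatConduction.ChainConfig)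
        (D : Literature.MathematicalPhysics.KineticTheory.HeatConduction.InfiniteChainDynamics
          (Literature.MathematicalPhysics.KineticTheory.HeatConduction.pinnedChain ω₂ lam β γ)),
        (Literature.MathematicalPhysics.KineticTheory.HeatConduction.pinnedChain
            ω₂ lam β γ).IsChainGibbsMeasure T μT →
        Literature.MathematicalPhysics.KineticTheory.HeatConduction.IsShiftInvariant μT →
        (Literature.MathematicalPhysics.KineticTheory.HeatConduction.pinnedChain
            ω₂ lam β γ).HasSuperstabilityEstimate μT →
        D.carrier ⊆ (Literature.MathematicalPhysics.KineticTheory.HeatConduction.pinnedChain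
            ω₂ lam β γ).bmGood →
        D.PreservesMeasure μT →
        (∀ t : ℝ, D.HasAbsConvergentCorrelation μT t) →
        ∀ L : ℝ,
          Filter.Tendsto (fun N : ℕ =>
              if hN : 2 ≤ N then
                ∑ k : Fin N, ∫ t in Set.Ioi (0 : ℝ),
              ∫ z, (Literature.MathematicalPhysics.KineticTheory.HeatConduction.pinnedChain
                      ω₂ lam β γ).bondCurrent N ⟨(N - 1) / 2, by omega⟩ z *
                (∫ y, (Literature.MathematicalPhysics.KineticTheory.HeatConduction.pinnedChain
                      ω₂ lam β γ).bondCurrent N k y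
                  ∂((Literature.MathematicalPhysics.KineticTheory.HeatConduction.pinnedChain
                      ω₂ lam β γ).transitionKernel N T T t.toNNReal z))
              ∂((Literature.MathematicalPhysics.KineticTheory.HeatConduction.pinnedChain
                      ω₂ lam β γ).gibbsMeasure N T)
              else 0)
            Filter.atTop (nhds L) →
          Filter.Tendsto (fun ν : ℝ =>
              MeasureTheory.integral (MeasureTheory.volume.restrict (Set.Ioi (0:ℝ)))
                (fun t : ℝ => Real.exp (-(ν * t)) * D.currentCorrelation μT t))
            (nhdsWithin (0:ℝ) (Set.Ioi 0)) (nhds L) →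
          ∀ ε : ℝ, 0 < ε → ∃ τ₀ : ℝ, 0 < τ₀ ∧ ∀ τ : ℝ, τ₀ ≤ τ → ∃ N₀ : ℕ, ∀ (N : ℕ), N₀ ≤ N →
            ∀ hN : 2 ≤ N,
              |(∑ k : Fin N, ∫ t in Set.Ioi (0 : ℝ),
              ∫ z, (Literature.MathematicalPhysics.KineticTheory.HeatConduction.pinnedChain
                      ω₂ lam β γ).bondCurrent N ⟨(N - 1) / 2, by omega⟩ z *
                (∫ y, (Literature.MathematicalPhysics.KineticTheory.HeatConduction.pinnedChain
                      ω₂ lam β γ).bondCurrent N k y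
                  ∂((Literature.MathematicalPhysics.KineticTheory.HeatConduction.pinnedChain
                      ω₂ lam β γ).transitionKernel N T T t.toNNReal z))
              ∂((Literature.MathematicalPhysics.KineticTheory.HeatConduction.pinnedChain
                      ω₂ lam β γ).gibbsMeasure N T)) -
                (∑ k : Fin N, ∫ t in Set.Ioc (0 : ℝ) τ, (1 - t / τ) ^ 2 *
              ∫ z, (Literature.MathematicalPhysics.KineticTheory.HeatConduction.pinnedChain
                      ω₂ lam β γ).bondCurrent N ⟨(N - 1) / 2, by omega⟩ z *
                (∫ y, (Literature.MathematicalPhysics.KineticTheory.HeatConduction.pinnedChain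
                      ω₂ lam β γ).bondCurrent N k y
                  ∂((Literature.MathematicalPhysics.KineticTheory.HeatConduction.pinnedChain
                      ω₂ lam β γ).transitionKernel N T T t.toNNReal z))
              ∂((Literature.MathematicalPhysics.KineticTheory.HeatConduction.pinnedChain
                      ω₂ lam β γ).gibbsMeasure N T))| ≤ ε := by
  intro ω₂ lam β γ hω hl hβ hγ T hT μT D hG hS hss hcar hP hAC L hA hL ε hε
  -- shorthand (proof-side only)
  let K : (N : ℕ) → 2 ≤ N → Fin N → ℝ → ℝ := fun N hN k t =>
    ∫ z, (pinnedChain ω₂ lam β γ).bondCurrent N ⟨(N - 1) / 2, by omega⟩ z *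
        (∫ y, (pinnedChain ω₂ lam β γ).bondCurrent N k y
            ∂((pinnedChain ω₂ lam β γ).transitionKernel N T T t.toNNReal z))
      ∂((pinnedChain ω₂ lam β γ).gibbsMeasure N T)
  let A : ℕ → ℝ := fun N => if h : 2 ≤ N then ∑ k : Fin N, ∫ t in Ioi (0:ℝ), K N h k t else 0
  let W : ℕ → ℝ → ℝ := fun N τ =>
    if h : 2 ≤ N then ∑ k : Fin N, ∫ t in Ioc (0:ℝ) τ, (1 - t / τ) ^ 2 * K N h k t else 0
  let g : ℝ → ℝ := fun τ => ∫ t in Ioc (0 : ℝ) τ, (1 - t / τ) ^ 2 * D.currentCorrelation μT t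
  -- the anchored DC values converge (hypothesis)
  have hd : Tendsto A atTop (𝓝 L) := hA
  -- witness side: positive type (S2), then Karamata at index 2 (S1)
  obtain ⟨hmeas, ⟨M, hM⟩, hV⟩ :=
    stub_witnessPositiveType ω₂ lam β γ hω hl hβ hγ T hT μT D hG hS hss hcar hP hAC
  have hg : Tendsto g atTop (𝓝 L) :=
    stub_karamataRieszTwo (D.currentCorrelation μT) L M hmeas hM hV hL
  -- matching at fixed horizon (S4 from the two dynamical leaves, fed S7)
  have hmatch : ∀ τ : ℝ, 0 < τ → Tendsto (fun N : ℕ => W N τ) atTop (𝓝 (g τ)) :=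
    stub_fixedHorizonMatchingOfDynamicalLeaves ω₂ lam β γ hω hl hβ hγ T hT
      (stub_anchoredCorrelationTails ω₂ lam β γ hω hl hβ hγ T hT)
      (stub_regularDLRUnique ω₂ lam β γ hω hl hβ hγ T hT) μT D hG hS hss hcar hP hAC
      (stub_fixedTimeOffsetMatching ω₂ lam β γ hω hl hβ hγ T hT
        (stub_regularDLRUnique ω₂ lam β γ hω hl hβ hγ T hT) μT D hG hS hss hcar hP hAC)
  -- ε/3 bookkeeping, then unfold the `dite`s at `N ≥ 2`
  obtain ⟨τ₀, hτ₀, hτ⟩ := window_stability_of_tendsto hd hg hmatch ε hε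
  refine ⟨τ₀, hτ₀, fun τ hττ => ?_⟩
  obtain ⟨N₀, hN₀⟩ := hτ τ hττ
  refine ⟨N₀, fun N hN hN2 => ?_⟩
  have h := hN₀ N hN
  have hA2 : A N = ∑ k : Fin N, ∫ t in Ioi (0:ℝ), K N hN2 k t := dif_pos hN2
  have hW2 : W N τ = ∑ k : Fin N, ∫ t in Ioc (0:ℝ) τ, (1 - t / τ) ^ 2 * K N hN2 k t :=
    dif_pos hN2
  rw [hA2, hW2] at h
  exact h

end Summit.AtomisticToContinuum.FouriersLaw.Theorems.AbelThermodynamicLimit.LoomisCompactHorizonWitness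

end
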